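import Summits.CriticalPhenomena.PercolationContinuityZ3.Theorems.PercNearOneGluingNoHeavyQuantLSCoreMMGIneqA
import Mathlib.Tactic.FieldSimp
import Mathlib.Tactic.Ring
import Mathlib.Tactic.Linarith
import Mathlib.Tactic.Positivity
import HarnessLib

/-!
# QUANT lane R8, T-DEC, binder (II) `ConvClosedTResidue`: LS-CORE, pattern LMG — the giant breakpoint `kG` on the cell
# "pre-routing pair light (fits), head pair of low 2 heavy, mid `m+l′` unavailable, `2γ ≤ 1`", region `2D ≥ x` (part J, by hand)

builds on p205010 (kernel theorem, internal audit signed; external expert review pending)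

Support file (`--supports stmt-CriticalPhenomena-4575`), QUANT lane seat prim-quant-census-1 (gen 22), rung R8 of
`run/shared/lean/prim/quant/LADDER.md`.  Memo `run/shared/lean/prim/quant/prim-quant-census-1/LSCORE-G22.md` §12–§13.  Theorems only,
standard axioms, no sorries.

Coordinates of `…QuantLSCoreLMGIneqA` (`x, r, t, d, w`; `A = r + d`, `D = t(2 − x² − (1−x)r) − x(x−r)`, `γ = x² + (1−x)d/w`,
`λ = (x−r)(1−t−r)/D`, `λ′ = 1 − λ`).  On this cell the breakpoint inequality reads `P₁ + P₂ ≤ c′_P·(1/A − 1) + pool` with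
`c′_P = (1−γ)x − d₁/e₃` the head-cell capacity left by the pre-routed low `m+l`.  Multiplying by `A`:
`F·A = P − (d₁/e₃)(1−A)` with `P = γA(1−x) − (1−γ)(A−x)`.  Since the pre-routing pair is light, `e₃ ≥ (1−x)/x`, so `d₁/e₃ ≤ γxλ`; since
`w ≤ A`, `γ ≥ x² + (1−x)d/A` and `P ≥ (1−x)[(xA−d)²/A + (x−r)(1+x−d/A)] ≥ (1−x)(x−r)`; and on the region `2D ≥ x`, with `2γ ≤ 1`,
`γxλ(1−A) = γx(1−A)(x−r)(1−t−r)/D ≤ (1−x)(x−r)`.  Hence `F ≥ 0`.  (The complementary region `2D ≤ x` is part K.)  [this work].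
The gluing rows served [cite: KozmaNitzan2024, Conjecture 3 (p. 15)]; product measure [cite: Grimmett1999, §1.3 p. 10].
-/

namespace Summit.CriticalPhenomena.PercolationContinuityZ3.Theorems

namespace Quant

namespace LawDec

namespace LSCoreLMG

set_option maxHeartbeats 4000000 in
/-- **`kG`, pattern LMG, cell `3PL fit / 22 unavailable / 2P heavy`, sub-region `2γ ≤ 1`, `2D ≥ x`** (hand proof, see the module
docstring): `P₁ + P₂ ≤ ((1−γ)x − d₁/e₃)·(1/A − 1) + γ(1−x)`. [this work] -/
theorem kG_3PLf_N_H_regionG (x r t d w : ℝ) (hx0 : 0 < x) (hx1 : x < 1) (hr0 : 0 ≤ r) (hrx : r < x)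
    (hw0 : 0 < w) (hd0 : 0 ≤ d) (hdx : d < x * w) (hre : 0 < r - x + t * (2 - x)) (hre1 : 0 < 1 - t - r)
    (hM1 : 2 * w < r + d + 2 * t)
    (h22n : w ≤ r + d) (h2H : x ≤ r + d) (h2b : r + d < 1) (hk3 : r + d + 2 * t - 2 * w < x * (1 + t - w))
    (hQ : 2 * (x ^ 2 + (1 - x) * d / w) ≤ 1) (hD2 : x ≤ 2 * (t * (2 - x ^ 2 - (1 - x) * r) - x * (x - r))) :
    ((1 - (x ^ 2 + (1 - x) * d / w)) * (1 - x) * ((x - r) * (1 - t - r) / (t * (2 - x ^ 2 - (1 - x) * r) - x * (x - r))))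
      + ((1 - (x ^ 2 + (1 - x) * d / w)) * (1 - x) * ((1 + x - r) * (r - x + t * (2 - x)) / (t * (2 - x ^ 2 - (1 - x) * r) - x * (x - r))))
      ≤ (((1 - (x ^ 2 + (1 - x) * d / w)) * x) - ((x ^ 2 + (1 - x) * d / w) * (1 - x) * ((x - r) * (1 - t - r) / (t * (2 - x ^ 2 - (1 - x) * r) - x * (x - r))))
          / (((1 + t - w) - ((1 - x) * (r + d + 2 * t - 2 * w) + x ^ 2 * (1 + t - w))) / ((1 - x) * (r + d + 2 * t - 2 * w) + x ^ 2 * (1 + t - w))))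
        * (1 / (r + d) - 1) + ((x ^ 2 + (1 - x) * d / w) * (1 - x)) := by
  have hD : 0 < t * (2 - x ^ 2 - (1 - x) * r) - x * (x - r) := LSCoreMMG.D_pos x r t hx0 hx1 hr0 hrx hre
  set Dv : ℝ := t * (2 - x ^ 2 - (1 - x) * r) - x * (x - r) with hDv
  set gg : ℝ := x ^ 2 + (1 - x) * d / w with hgg
  set Lm : ℝ := (x - r) * (1 - t - r) / Dv with hLm
  set Lp : ℝ := (1 + x - r) * (r - x + t * (2 - x)) / Dv with hLp
  set G3 : ℝ := (1 - x) * (r + d + 2 * t - 2 * w) + x ^ 2 * (1 + t - w) with hG3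
  set ee : ℝ := ((1 + t - w) - G3) / G3 with hee
  set Av : ℝ := r + d with hAv
  -- basic signs
  have hA0 : 0 < Av := by rw [hAv]; linarith
  have hA1 : 0 < 1 - Av := by rw [hAv]; linarith
  have hxw : x * w ≤ x * Av := by rw [hAv]; nlinarith
  have hdA : d ≤ x * Av := by linarith
  have hg0 : 0 ≤ gg := by rw [hgg]; positivity
  have hg2 : gg ≤ 1 / 2 := by linarith
  have hsum : Lm + Lp = 1 := by rw [hLm, hLp, ← add_div, div_eq_one_iff_eq hD.ne']; ring
  have hLm0 : 0 ≤ Lm := by rw [hLm]; exact div_nonneg (mul_nonneg (by linarith) (by linarith)) hD.le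
  have hcM1 : 0 ≤ gg * (1 - x) * Lm := mul_nonneg (mul_nonneg hg0 (by linarith)) hLm0
  -- the pre-routing pair is light: e₃ ≥ (1−x)/x > 0
  have hB3 : 0 < r + d + 2 * t - 2 * w := by linarith
  have hG3pos : 0 < G3 := by
    rw [hG3]; exact add_pos_of_pos_of_nonneg (mul_pos (by linarith) hB3) (mul_nonneg (sq_nonneg x) (by linarith))
  have hG3le : G3 ≤ x * (1 + t - w) := by rw [hG3]; nlinarith [mul_pos hx0 (sub_pos.2 hx1)]
  have hEX : 0 < (1 - x) / x := div_pos (by linarith) hx0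
  have he3 : (1 - x) / x ≤ ee := by
    rw [hee, div_le_div_iff₀ hx0 hG3pos]; nlinarith [mul_pos hx0 (sub_pos.2 hx1)]
  have he3pos : 0 < ee := lt_of_lt_of_le hEX he3
  -- d₁/e₃ ≤ γ x λ
  have hmu : gg * (1 - x) * Lm / ee ≤ gg * (1 - x) * Lm / ((1 - x) / x) := div_le_div_of_nonneg_left hcM1 hEX he3
  have hmu' : gg * (1 - x) * Lm / ((1 - x) / x) = gg * x * Lm := by
    have hx1ne : (1:ℝ) - x ≠ 0 := by linarith
    field_simp
  rw [hmu'] at hmu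
  -- P ≥ (1−x)(x−r)
  have hgA : x ^ 2 + (1 - x) * d / Av ≤ gg := by
    rw [hgg]
    have h1 : d / Av ≤ d / w := div_le_div_of_nonneg_left hd0 hw0 (by rw [hAv]; exact h22n)
    have h2 : (1 - x) * d / Av ≤ (1 - x) * d / w := by
      rw [mul_div_assoc, mul_div_assoc]; exact mul_le_mul_of_nonneg_left h1 (by linarith)
    linarith
  have hP0 : (x ^ 2 + (1 - x) * d / Av) * Av * (1 - x) - (1 - (x ^ 2 + (1 - x) * d / Av)) * (Av - x) ≥ (1 - x) * (x - r) := by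
    have hAne : Av ≠ 0 := hA0.ne'
    have hr : x - r = x - Av + d := by rw [hAv]; ring
    have key : ((x ^ 2 + (1 - x) * d / Av) * Av * (1 - x) - (1 - (x ^ 2 + (1 - x) * d / Av)) * (Av - x)) * Av
        = (1 - x) * ((x * Av - d) ^ 2 + (x - Av + d) * (Av * (1 + x) - d)) := by
      field_simp; ring
    have hsq : 0 ≤ (x * Av - d) ^ 2 := sq_nonneg _
    have hs0 : 0 ≤ x - Av + d := by linarith
    have hlin : (x - Av + d) * Av ≤ (x - Av + d) * (Av * (1 + x) - d) := by
      apply mul_le_mul_of_nonneg_left _ hs0; nlinarith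
    have h2 : ((1 - x) * (x - r)) * Av ≤ ((x ^ 2 + (1 - x) * d / Av) * Av * (1 - x) - (1 - (x ^ 2 + (1 - x) * d / Av)) * (Av - x)) * Av := by
      rw [key, hr]; nlinarith [mul_nonneg (show (0:ℝ) ≤ 1 - x by linarith) hsq, mul_le_mul_of_nonneg_left hlin (show (0:ℝ) ≤ 1 - x by linarith)]
    exact le_of_mul_le_mul_right h2 hA0
  have hPmono : gg * Av * (1 - x) - (1 - gg) * (Av - x) ≥ (x ^ 2 + (1 - x) * d / Av) * Av * (1 - x) - (1 - (x ^ 2 + (1 - x) * d / Av)) * (Av - x) := by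
    have h1 : 0 ≤ Av * (1 - x) + (Av - x) := by rw [hAv]; nlinarith
    nlinarith [mul_le_mul_of_nonneg_right hgA h1]
  -- γ x λ (1−A) ≤ (1−x)(x−r) on the region 2D ≥ x
  have hlam : gg * x * Lm * (1 - Av) ≤ (1 - x) * (x - r) := by
    have e1 : gg * x * Lm * (1 - Av) = (gg * (1 - Av) * (1 - t - r)) * (x - r) * (x / Dv) := by
      rw [hLm]; field_simp
    have f1 : gg * (1 - Av) * (1 - t - r) ≤ (1 / 2) * (1 - x) * 1 := by
      have a1 : gg * (1 - Av) ≤ (1 / 2) * (1 - x) := by nlinarith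
      calc gg * (1 - Av) * (1 - t - r) ≤ (1 / 2) * (1 - x) * (1 - t - r) := mul_le_mul_of_nonneg_right a1 (by linarith)
        _ ≤ (1 / 2) * (1 - x) * 1 := mul_le_mul_of_nonneg_left (by linarith) (by linarith)
    have f2 : x / Dv ≤ 2 := by rw [div_le_iff₀ hD]; linarith
    have f3 : (gg * (1 - Av) * (1 - t - r)) * (x - r) * (x / Dv) ≤ ((1 / 2) * (1 - x) * 1) * (x - r) * 2 := by
      have s0 : 0 ≤ gg * (1 - Av) * (1 - t - r) := mul_nonneg (mul_nonneg hg0 hA1.le) (by linarith)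
      have := mul_le_mul (mul_le_mul_of_nonneg_right f1 (show (0:ℝ) ≤ x - r by linarith)) f2 (div_nonneg hx0.le hD.le)
        (mul_nonneg (by positivity) (by linarith))
      linarith
    rw [e1]; linarith
  -- assemble: F·A = P − (d₁/e₃)(1−A) ≥ P − γxλ(1−A) ≥ 0
  have hF : 0 ≤ ((1 - gg) * x - gg * (1 - x) * Lm / ee) * (1 / Av - 1) + gg * (1 - x) - (1 - gg) * (1 - x) := by
    have key : (((1 - gg) * x - gg * (1 - x) * Lm / ee) * (1 / Av - 1) + gg * (1 - x) - (1 - gg) * (1 - x)) * Av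
        = (gg * Av * (1 - x) - (1 - gg) * (Av - x)) - (gg * (1 - x) * Lm / ee) * (1 - Av) := by
      field_simp; ring
    have hnum : 0 ≤ (gg * Av * (1 - x) - (1 - gg) * (Av - x)) - (gg * (1 - x) * Lm / ee) * (1 - Av) := by
      nlinarith [mul_le_mul_of_nonneg_right hmu hA1.le]
    exact (mul_nonneg_iff_of_pos_right hA0).1 (by rw [key]; exact hnum)
  have hP : (1 - gg) * (1 - x) * Lm + (1 - gg) * (1 - x) * Lp = (1 - gg) * (1 - x) := by
    linear_combination (1 - gg) * (1 - x) * hsum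
  linarith [hF, hP]

set_option maxHeartbeats 4000000 in
/-- **`kG`, pattern LMG, cell `3PL fit / 22 unavailable / 2P heavy`, sub-region `2γ ≤ 1`, `D ≥ x²`** (hand proof as for `2D ≥ x`,
using `γ ≤ x` instead of `γ ≤ 1/2`): `P₁ + P₂ ≤ ((1−γ)x − d₁/e₃)·(1/A − 1) + γ(1−x)`. [this work] -/
theorem kG_3PLf_N_H_regionG2 (x r t d w : ℝ) (hx0 : 0 < x) (hx1 : x < 1) (hr0 : 0 ≤ r) (hrx : r < x)
    (hw0 : 0 < w) (hd0 : 0 ≤ d) (hdx : d < x * w) (hre : 0 < r - x + t * (2 - x)) (hre1 : 0 < 1 - t - r)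
    (hM1 : 2 * w < r + d + 2 * t)
    (h22n : w ≤ r + d) (h2H : x ≤ r + d) (h2b : r + d < 1) (hk3 : r + d + 2 * t - 2 * w < x * (1 + t - w))
    (hQ : 2 * (x ^ 2 + (1 - x) * d / w) ≤ 1) (hD2 : x ^ 2 ≤ t * (2 - x ^ 2 - (1 - x) * r) - x * (x - r)) :
    ((1 - (x ^ 2 + (1 - x) * d / w)) * (1 - x) * ((x - r) * (1 - t - r) / (t * (2 - x ^ 2 - (1 - x) * r) - x * (x - r))))
      + ((1 - (x ^ 2 + (1 - x) * d / w)) * (1 - x) * ((1 + x - r) * (r - x + t * (2 - x)) / (t * (2 - x ^ 2 - (1 - x) * r) - x * (x - r))))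
      ≤ (((1 - (x ^ 2 + (1 - x) * d / w)) * x) - ((x ^ 2 + (1 - x) * d / w) * (1 - x) * ((x - r) * (1 - t - r) / (t * (2 - x ^ 2 - (1 - x) * r) - x * (x - r))))
          / (((1 + t - w) - ((1 - x) * (r + d + 2 * t - 2 * w) + x ^ 2 * (1 + t - w))) / ((1 - x) * (r + d + 2 * t - 2 * w) + x ^ 2 * (1 + t - w))))
        * (1 / (r + d) - 1) + ((x ^ 2 + (1 - x) * d / w) * (1 - x)) := by
  have hD : 0 < t * (2 - x ^ 2 - (1 - x) * r) - x * (x - r) := LSCoreMMG.D_pos x r t hx0 hx1 hr0 hrx hre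
  set Dv : ℝ := t * (2 - x ^ 2 - (1 - x) * r) - x * (x - r) with hDv
  set gg : ℝ := x ^ 2 + (1 - x) * d / w with hgg
  set Lm : ℝ := (x - r) * (1 - t - r) / Dv with hLm
  set Lp : ℝ := (1 + x - r) * (r - x + t * (2 - x)) / Dv with hLp
  set G3 : ℝ := (1 - x) * (r + d + 2 * t - 2 * w) + x ^ 2 * (1 + t - w) with hG3
  set ee : ℝ := ((1 + t - w) - G3) / G3 with hee
  set Av : ℝ := r + d with hAv
  -- basic signs
  have hA0 : 0 < Av := by rw [hAv]; linarith
  have hA1 : 0 < 1 - Av := by rw [hAv]; linarith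
  have hxw : x * w ≤ x * Av := by rw [hAv]; nlinarith
  have hdA : d ≤ x * Av := by linarith
  have hg0 : 0 ≤ gg := by rw [hgg]; positivity
  have hg2 : gg ≤ 1 / 2 := by linarith
  have hsum : Lm + Lp = 1 := by rw [hLm, hLp, ← add_div, div_eq_one_iff_eq hD.ne']; ring
  have hLm0 : 0 ≤ Lm := by rw [hLm]; exact div_nonneg (mul_nonneg (by linarith) (by linarith)) hD.le
  have hcM1 : 0 ≤ gg * (1 - x) * Lm := mul_nonneg (mul_nonneg hg0 (by linarith)) hLm0
  -- the pre-routing pair is light: e₃ ≥ (1−x)/x > 0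
  have hB3 : 0 < r + d + 2 * t - 2 * w := by linarith
  have hG3pos : 0 < G3 := by
    rw [hG3]; exact add_pos_of_pos_of_nonneg (mul_pos (by linarith) hB3) (mul_nonneg (sq_nonneg x) (by linarith))
  have hG3le : G3 ≤ x * (1 + t - w) := by rw [hG3]; nlinarith [mul_pos hx0 (sub_pos.2 hx1)]
  have hEX : 0 < (1 - x) / x := div_pos (by linarith) hx0
  have he3 : (1 - x) / x ≤ ee := by
    rw [hee, div_le_div_iff₀ hx0 hG3pos]; nlinarith [mul_pos hx0 (sub_pos.2 hx1)]
  have he3pos : 0 < ee := lt_of_lt_of_le hEX he3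
  -- d₁/e₃ ≤ γ x λ
  have hmu : gg * (1 - x) * Lm / ee ≤ gg * (1 - x) * Lm / ((1 - x) / x) := div_le_div_of_nonneg_left hcM1 hEX he3
  have hmu' : gg * (1 - x) * Lm / ((1 - x) / x) = gg * x * Lm := by
    have hx1ne : (1:ℝ) - x ≠ 0 := by linarith
    field_simp
  rw [hmu'] at hmu
  -- P ≥ (1−x)(x−r)
  have hgA : x ^ 2 + (1 - x) * d / Av ≤ gg := by
    rw [hgg]
    have h1 : d / Av ≤ d / w := div_le_div_of_nonneg_left hd0 hw0 (by rw [hAv]; exact h22n)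
    have h2 : (1 - x) * d / Av ≤ (1 - x) * d / w := by
      rw [mul_div_assoc, mul_div_assoc]; exact mul_le_mul_of_nonneg_left h1 (by linarith)
    linarith
  have hP0 : (x ^ 2 + (1 - x) * d / Av) * Av * (1 - x) - (1 - (x ^ 2 + (1 - x) * d / Av)) * (Av - x) ≥ (1 - x) * (x - r) := by
    have hAne : Av ≠ 0 := hA0.ne'
    have hr : x - r = x - Av + d := by rw [hAv]; ring
    have key : ((x ^ 2 + (1 - x) * d / Av) * Av * (1 - x) - (1 - (x ^ 2 + (1 - x) * d / Av)) * (Av - x)) * Av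
        = (1 - x) * ((x * Av - d) ^ 2 + (x - Av + d) * (Av * (1 + x) - d)) := by
      field_simp; ring
    have hsq : 0 ≤ (x * Av - d) ^ 2 := sq_nonneg _
    have hs0 : 0 ≤ x - Av + d := by linarith
    have hlin : (x - Av + d) * Av ≤ (x - Av + d) * (Av * (1 + x) - d) := by
      apply mul_le_mul_of_nonneg_left _ hs0; nlinarith
    have h2 : ((1 - x) * (x - r)) * Av ≤ ((x ^ 2 + (1 - x) * d / Av) * Av * (1 - x) - (1 - (x ^ 2 + (1 - x) * d / Av)) * (Av - x)) * Av := by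
      rw [key, hr]; nlinarith [mul_nonneg (show (0:ℝ) ≤ 1 - x by linarith) hsq, mul_le_mul_of_nonneg_left hlin (show (0:ℝ) ≤ 1 - x by linarith)]
    exact le_of_mul_le_mul_right h2 hA0
  have hPmono : gg * Av * (1 - x) - (1 - gg) * (Av - x) ≥ (x ^ 2 + (1 - x) * d / Av) * Av * (1 - x) - (1 - (x ^ 2 + (1 - x) * d / Av)) * (Av - x) := by
    have h1 : 0 ≤ Av * (1 - x) + (Av - x) := by rw [hAv]; nlinarith
    nlinarith [mul_le_mul_of_nonneg_right hgA h1]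
  -- γ x λ (1−A) ≤ (1−x)(x−r) on the region 2D ≥ x
  have hlam : gg * x * Lm * (1 - Av) ≤ (1 - x) * (x - r) := by
    have e1 : gg * x * Lm * (1 - Av) = (gg * (1 - Av) * (1 - t - r)) * (x - r) * (x / Dv) := by
      rw [hLm]; field_simp
    have hgx : gg ≤ x := by
      rw [hgg]
      have h4 : d / w ≤ x := by rw [div_le_iff₀ hw0]; linarith
      have h5 : (1 - x) * d / w ≤ (1 - x) * x := by rw [mul_div_assoc]; exact mul_le_mul_of_nonneg_left h4 (by linarith)
      nlinarith
    have f1 : gg * (1 - Av) * (1 - t - r) ≤ x * (1 - x) * 1 := by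
      have a1 : gg * (1 - Av) ≤ x * (1 - x) := by nlinarith
      calc gg * (1 - Av) * (1 - t - r) ≤ x * (1 - x) * (1 - t - r) := mul_le_mul_of_nonneg_right a1 (by linarith)
        _ ≤ x * (1 - x) * 1 := mul_le_mul_of_nonneg_left (by linarith) (by nlinarith)
    have f2 : x / Dv ≤ 1 / x := by rw [div_le_div_iff₀ hD hx0]; nlinarith
    have f3 : (gg * (1 - Av) * (1 - t - r)) * (x - r) * (x / Dv) ≤ (x * (1 - x) * 1) * (x - r) * (1 / x) := by
      have s0 : 0 ≤ gg * (1 - Av) * (1 - t - r) := mul_nonneg (mul_nonneg hg0 hA1.le) (by linarith)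
      exact mul_le_mul (mul_le_mul_of_nonneg_right f1 (show (0:ℝ) ≤ x - r by linarith)) f2 (div_nonneg hx0.le hD.le)
        (mul_nonneg (by positivity) (by linarith))
    have e2 : (x * (1 - x) * 1) * (x - r) * (1 / x) = (1 - x) * (x - r) := by field_simp
    rw [e1]; linarith
  -- assemble: F·A = P − (d₁/e₃)(1−A) ≥ P − γxλ(1−A) ≥ 0
  have hF : 0 ≤ ((1 - gg) * x - gg * (1 - x) * Lm / ee) * (1 / Av - 1) + gg * (1 - x) - (1 - gg) * (1 - x) := by
    have key : (((1 - gg) * x - gg * (1 - x) * Lm / ee) * (1 / Av - 1) + gg * (1 - x) - (1 - gg) * (1 - x)) * Av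
        = (gg * Av * (1 - x) - (1 - gg) * (Av - x)) - (gg * (1 - x) * Lm / ee) * (1 - Av) := by
      field_simp; ring
    have hnum : 0 ≤ (gg * Av * (1 - x) - (1 - gg) * (Av - x)) - (gg * (1 - x) * Lm / ee) * (1 - Av) := by
      nlinarith [mul_le_mul_of_nonneg_right hmu hA1.le]
    exact (mul_nonneg_iff_of_pos_right hA0).1 (by rw [key]; exact hnum)
  have hP : (1 - gg) * (1 - x) * Lm + (1 - gg) * (1 - x) * Lp = (1 - gg) * (1 - x) := by
    linear_combination (1 - gg) * (1 - x) * hsum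
  linarith [hF, hP]

end LSCoreLMG

end LawDec

end Quant

end Summit.CriticalPhenomena.PercolationContinuityZ3.Theorems
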